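import Mathlib
import Summits.Ventures.PercRepro2.Defs
import Summits.Ventures.PercRepro2.Independence
import Summits.Ventures.PercRepro2.Harris
import Summits.Ventures.PercRepro2.Graph
import Summits.Ventures.PercRepro2.Exploration
import Summits.Ventures.PercRepro2.Events
import Summits.Ventures.PercRepro2.FourFunctions
import Summits.Ventures.PercRepro2.Induced
import Summits.Ventures.PercRepro2.Frontier
import Summits.Ventures.PercRepro2.ObsIndependence
import Summits.Ventures.PercRepro2.BHK
import Summits.Ventures.PercRepro2.BHKEvents
import Summits.Ventures.PercRepro2.OrderPreservation
import Summits.Ventures.PercRepro2.OrderPreservationDual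
import Summits.Ventures.PercRepro2.VdBKahn
import Summits.Ventures.PercRepro2.BHKAvoid
import Summits.Ventures.PercRepro2.R2PrimeThreeReduction
import Summits.Ventures.PercRepro2.YBridge
import Summits.Ventures.PercRepro2.Yu1Functionals
import Summits.Ventures.PercRepro2.Yu1Events
import Summits.Ventures.PercRepro2.Yu1
import Summits.Ventures.PercRepro2.LBSplit
import Summits.Ventures.PercRepro2.YDelta
import Summits.Ventures.PercRepro2.SD

/-!
# ΛM (Λ-monotonicity at the poles): (SD) for configuration functionals
(blind cell PercRepro2, typer-1; lead g6 ADDENDUM 15 (2), INBOX 2026-08-22T22:39:03Z)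

Light exploration `S = C(a₁)` on `R = {a₂, a₃ ∉ S}`; `u, β, 1_b, ψ = β − 1_b(1 − u)` as in `SD`;
`W = M₂ + Δ_T = E[ψ; R]` (`expect_psi_eq`), `P(PD) = E[u; R]` (`expect_u_eq`), `Λ := W / P(PD)`.

* `SDLightCfg F`: (SD)_l for a **configuration** functional `F : Config E → R`:
  `E[F ψ(C₁); R] · P(PD) ≤ E[F u(C₁); R] · W` (`SDLightFun` is the case `F = F′ ∘ C₁`).
* **ΛM** at an edge `e`: `LamMono e := SDLightCfg 1{e open}` — equivalently `Λ(G/e) ≤ Λ(G) ≤ Λ(G−e)`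
  (the mediant); `LamMono_iff_compl`: it is the reversed inequality for `1{e closed}`.
  The census statement (ADDENDUM 15 (2)): under the R-order, `LamMono e` for every edge `e` at `a₁`
  and its reverse `LamMonoRev e` for every edge at `a₂` or `a₃` (`LamMono_all`, `LamMonoRev_all`) —
  typed statements, NOT theorems.
* `expect_comb`: the linearity of `expect` used by the `Lambda*` files.

Continued in `LambdaTau.lean` (the `λ < 1` weights `τ, τ₀, τ₁`), `LambdaSlack.lean` (the exact
slack decomposition and the BHK bracket) and `LayerCake.lean` (up-set form ⟺ functional form).
-/

namespace Summit.Ventures.PercRepro2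

open UnionCluster Yu1

namespace Lambda

section CfgDefs

variable {V : Type*} {E : Type*} [Fintype E] [DecidableEq E] [Fintype V] [DecidableEq V]
  {R : Type*} [Field R] [LinearOrder R] [IsStrictOrderedRing R]

/-- **(SD)_l for a configuration functional** `F : Config E → R`:
`E[F ψ(C₁); R] · P(PD) ≤ E[F u(C₁); R] · W`. -/
def SDLightCfg (p : E → R) (ends : E → Sym2 V) (a₁ a₂ a₃ b : V) (F : Config E → R) : Prop :=
  expect p (fun ω => F ω * psi p ends a₂ a₃ b (cluster ends ω a₁) *
      (avoidAll ends a₁ {a₂, a₃}).indicator 1 ω) * prob p (PDEvent ends a₁ a₂ a₃) ≤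
    expect p (fun ω => F ω * u p ends a₂ a₃ (cluster ends ω a₁) *
      (avoidAll ends a₁ {a₂, a₃}).indicator 1 ω) *
      (massM2 p ends a₁ a₂ a₃ b + deltaT p ends a₁ a₂ a₃ b)

/-- The reversed inequality `E[F u; R] · W ≤ E[F ψ; R] · P(PD)`. -/
def SDLightCfgRev (p : E → R) (ends : E → Sym2 V) (a₁ a₂ a₃ b : V) (F : Config E → R) : Prop :=
  expect p (fun ω => F ω * u p ends a₂ a₃ (cluster ends ω a₁) *
      (avoidAll ends a₁ {a₂, a₃}).indicator 1 ω) *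
      (massM2 p ends a₁ a₂ a₃ b + deltaT p ends a₁ a₂ a₃ b) ≤
    expect p (fun ω => F ω * psi p ends a₂ a₃ b (cluster ends ω a₁) *
      (avoidAll ends a₁ {a₂, a₃}).indicator 1 ω) * prob p (PDEvent ends a₁ a₂ a₃)

/-- **ΛM at the edge `e`** (ADDENDUM 15 (2)): (SD)_l for the increasing configuration event
`{e open}`; equivalently `Λ(G/e) ≤ Λ(G) ≤ Λ(G − e)`. -/
def LamMono (p : E → R) (ends : E → Sym2 V) (a₁ a₂ a₃ b : V) (e : E) : Prop :=
  SDLightCfg p ends a₁ a₂ a₃ b ((openEdge e).indicator 1)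

/-- **Reversed ΛM at the edge `e`**: `Λ(G/e) ≥ Λ(G) ≥ Λ(G − e)` (the census form at edges of
`a₂` and `a₃`). -/
def LamMonoRev (p : E → R) (ends : E → Sym2 V) (a₁ a₂ a₃ b : V) (e : E) : Prop :=
  SDLightCfgRev p ends a₁ a₂ a₃ b ((openEdge e).indicator 1)

omit [Fintype V] [IsStrictOrderedRing R] in
/-- `SDLightFun F` is `SDLightCfg (F ∘ C₁)`. -/
lemma SDLightFun_iff_cfg (p : E → R) (ends : E → Sym2 V) (a₁ a₂ a₃ b : V) (F : Set V → R) :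
    SDLightFun p ends a₁ a₂ a₃ b F ↔
      SDLightCfg p ends a₁ a₂ a₃ b (fun ω => F (cluster ends ω a₁)) :=
  Iff.rfl

end CfgDefs

section CfgClosures

variable (R : Type*) [Field R] [LinearOrder R] [IsStrictOrderedRing R]

/-- **ΛM at the light root, for every finite graph** (ADDENDUM 15 (2), census-clean under the
R-order `P(b ∈ C₁, R) ≤ P(b ∈ C₂, R)`): `Λ(G/e) ≤ Λ(G) ≤ Λ(G − e)` for every edge `e` at `a₁`. -/
def LamMono_all : Prop :=
  ∀ (V E : Type) [Fintype V] [DecidableEq V] [Fintype E] [DecidableEq E]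
    (ends : E → Sym2 V) (p : E → R), IsProbVec p →
    ∀ a₁ a₂ a₃ b : V, a₁ ≠ a₂ → a₁ ≠ a₃ → a₂ ≠ a₃ → b ≠ a₁ → b ≠ a₂ → b ≠ a₃ →
      prob p (connEvent ends a₁ b ∩ avoidAll ends a₁ {a₂, a₃}) ≤
        prob p (connEvent ends a₂ b ∩ avoidAll ends a₁ {a₂, a₃}) →
      ∀ e : E, a₁ ∈ ends e → LamMono p ends a₁ a₂ a₃ b e

/-- **Reversed ΛM at the heavy / third root, for every finite graph** (ADDENDUM 15 (2)):
`Λ(G/e) ≥ Λ(G) ≥ Λ(G − e)` for every edge `e` at `a₂` or `a₃`, under the R-order. -/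
def LamMonoRev_all : Prop :=
  ∀ (V E : Type) [Fintype V] [DecidableEq V] [Fintype E] [DecidableEq E]
    (ends : E → Sym2 V) (p : E → R), IsProbVec p →
    ∀ a₁ a₂ a₃ b : V, a₁ ≠ a₂ → a₁ ≠ a₃ → a₂ ≠ a₃ → b ≠ a₁ → b ≠ a₂ → b ≠ a₃ →
      prob p (connEvent ends a₁ b ∩ avoidAll ends a₁ {a₂, a₃}) ≤
        prob p (connEvent ends a₂ b ∩ avoidAll ends a₁ {a₂, a₃}) →
      ∀ e : E, (a₂ ∈ ends e ∨ a₃ ∈ ends e) → LamMonoRev p ends a₁ a₂ a₃ b e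

end CfgClosures

section Towers

variable {V : Type*} {E : Type*} [Fintype E] [DecidableEq E] [Fintype V] [DecidableEq V]
  {R : Type*} [Field R] [LinearOrder R] [IsStrictOrderedRing R]

omit [Fintype V] [DecidableEq V] [LinearOrder R] [IsStrictOrderedRing R] in
/-- Linearity of `expect` in the shape used in this file:
`E[c₁ f₁ + c₂ f₂] = c₁ E[f₁] + c₂ E[f₂]` (pointwise hypothesis). -/
lemma expect_comb (p : E → R) {g f₁ f₂ : Config E → R} {c₁ c₂ : R}
    (h : ∀ ω, g ω = c₁ * f₁ ω + c₂ * f₂ ω) :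
    expect p g = c₁ * expect p f₁ + c₂ * expect p f₂ := by
  simp only [expect]
  have h' : ∀ ω, weight p ω * g ω = c₁ * (weight p ω * f₁ ω) + c₂ * (weight p ω * f₂ ω) := by
    intro ω
    rw [h ω]
    ring
  simp only [h', Finset.sum_add_distrib, ← Finset.mul_sum]

omit [LinearOrder R] [IsStrictOrderedRing R] in
/-- `E[ψ(C₁); R] = W`. -/
lemma expect_psi_eq (p : E → R) (ends : E → Sym2 V) (a₁ a₂ a₃ b : V) :
    expect p (fun ω => psi p ends a₂ a₃ b (cluster ends ω a₁) *
        (avoidAll ends a₁ {a₂, a₃}).indicator 1 ω) =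
      massM2 p ends a₁ a₂ a₃ b + deltaT p ends a₁ a₂ a₃ b := by
  rw [W_eq]
  unfold expect
  rw [← Finset.sum_sub_distrib]
  refine Finset.sum_congr rfl fun ω _ => ?_
  unfold psi
  ring

omit [LinearOrder R] [IsStrictOrderedRing R] in
/-- `E[u(C₁); R] = P(PD)`. -/
lemma expect_u_eq (p : E → R) (ends : E → Sym2 V) (a₁ a₂ a₃ : V) :
    expect p (fun ω => u p ends a₂ a₃ (cluster ends ω a₁) *
        (avoidAll ends a₁ {a₂, a₃}).indicator 1 ω) = prob p (PDEvent ends a₁ a₂ a₃) :=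
  (tower_PD p ends a₁ a₂ a₃).symm

omit [Fintype E] [DecidableEq E] [Fintype V] [DecidableEq V] [LinearOrder R]
  [IsStrictOrderedRing R] in
/-- `1{e closed} = 1 − 1{e open}` pointwise. -/
lemma closedEdge_indicator_eq (e : E) (ω : Config E) :
    (closedEdge e).indicator (1 : Config E → R) ω = 1 - (openEdge e).indicator 1 ω := by
  by_cases h : ω e = true
  · have h1 : ω ∈ openEdge e := h
    have h2 : ω ∉ closedEdge e := by
      show ¬ ω e = false
      simp [h]
    simp [h1, h2]
  · have h1 : ω ∉ openEdge e := h
    have h2 : ω ∈ closedEdge e := by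
      show ω e = false
      simpa using h
    simp [h1, h2]

/-- **ΛM at `e` is the reversed (SD) at `{e closed}`**: `Λ(G/e) ≤ Λ(G)` iff `Λ(G) ≤ Λ(G − e)`
(the mediant property, through `E[ψ; R] = W`, `E[u; R] = P(PD)`). -/
theorem LamMono_iff_compl (p : E → R) (ends : E → Sym2 V) (a₁ a₂ a₃ b : V) (e : E) :
    LamMono p ends a₁ a₂ a₃ b e ↔
      SDLightCfgRev p ends a₁ a₂ a₃ b ((closedEdge e).indicator 1) := by
  unfold LamMono SDLightCfg SDLightCfgRev
  have e1 : expect p (fun ω => (closedEdge e).indicator (1 : Config E → R) ω *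
      psi p ends a₂ a₃ b (cluster ends ω a₁) * (avoidAll ends a₁ {a₂, a₃}).indicator 1 ω) =
      (massM2 p ends a₁ a₂ a₃ b + deltaT p ends a₁ a₂ a₃ b) -
        expect p (fun ω => (openEdge e).indicator (1 : Config E → R) ω *
          psi p ends a₂ a₃ b (cluster ends ω a₁) * (avoidAll ends a₁ {a₂, a₃}).indicator 1 ω) := by
    rw [← expect_psi_eq p ends a₁ a₂ a₃ b, ← expect_sub]
    congr 1
    funext ω
    simp only [Pi.sub_apply, closedEdge_indicator_eq]
    ring
  have e2 : expect p (fun ω => (closedEdge e).indicator (1 : Config E → R) ω *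
      u p ends a₂ a₃ (cluster ends ω a₁) * (avoidAll ends a₁ {a₂, a₃}).indicator 1 ω) =
      prob p (PDEvent ends a₁ a₂ a₃) -
        expect p (fun ω => (openEdge e).indicator (1 : Config E → R) ω *
          u p ends a₂ a₃ (cluster ends ω a₁) * (avoidAll ends a₁ {a₂, a₃}).indicator 1 ω) := by
    rw [← expect_u_eq p ends a₁ a₂ a₃, ← expect_sub]
    congr 1
    funext ω
    simp only [Pi.sub_apply, closedEdge_indicator_eq]
    ring
  rw [e1, e2]
  constructor
  · intro h
    linarith
  · intro h
    linarith

end Towers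

end Lambda

end Summit.Ventures.PercRepro2
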